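import Literature.NumberTheory.Automorphic.BCDTModularity
import Literature.NumberTheory.Automorphic.LanglandsTunnellModThree
import Literature.NumberTheory.EllipticCurves.NewformGaloisRepModLAssembly
import HarnessLib

/-!
# Stub-ideation k = 1, GENERATION 15 (home family 1 = RECOGNISE & IMPORT) for `stub_liftThree`
# of crux `FreyModularity` (stmt-ABC-11340, route ABC/DefiniteXi, `Lines/Sketch.lean`, sha 21576c53)

Companion of `STUB-IDEAS-stub_liftThree-1.md` (gen 15).  Gens 13–14 reduced `stub_liftThree` to
the socket `DiamondCSS62 3 → IN1 3 → OrdOfMult 3 → CrysOfGood 3 → ModularityLifting_tate 3` and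
split the weight adapter `IN1 3 = IN1one 3 ∧ IN1high 3`, with `IN1one 3` theorem-sized (Wiles'
`E_{1,χ₃}` trick, helpers H1–H4) and `IN1high 3` a named fact (Ash–Stevens-type, delicate at
`p = 3`).  This generation makes three TREE-MATCH corrections to that adapter:

* **T1 (`LTWeightOne`)** — the tree's proof of
  `ModPGaloisRep.isModular_of_isAbsolutelyIrreducible_of_isOdd_of_langlands_tunnell`
  (`LanglandsTunnellModThree`, Step 3) ends in `refine ⟨N, hN, 1, f, ℤ̄ ⧸ 𝔓, …, le_refl _, hnew, ?_⟩`: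
  the witness has WEIGHT ONE syntactically.  So the weight-refined statement `IsModularOfWeight 1 ρ̄`
  is a clone of that proof, and inside `stub_liftThree` the opaque any-weight hypothesis
  `ρ.IsModular` can be DISCARDED and regenerated in weight one from Langlands–Tunnell — a fact
  already on the crux's closing path (`stub_modThree`).  Consequence: `IN1high 3` leaves the
  closing path of `stub_liftThree`.
* **T2 (`WeightTwoNewformCongrThree'`)** — in that proof the coefficient map is
  `ι : 𝓞_f →+* ℤ̄ ⧸ 𝔓` (an algebraically closed residue field), not `→+* ZMod 3`; gen 14's H3 must be
  typed over an arbitrary field of characteristic `3`.  The Deligne–Serre clone it asks for uses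
  `ι`'s codomain only through "`ker ι` is a maximal ideal containing `3`", and its input (2.7.2) in
  weight one is PROVED (`DeligneSerre1974_span_integralLattice1_holds N 1`): H3′ carries no fact.
* **T3 (`AttachCofinite` / `AttachAtLevel`)** — the Galois input gen 14 named for H4
  (`eichlerShimuraConstruction`: `Γ₀(N)`, integer coefficients, OUTPUT a curve) is the wrong fact;
  descending the exceptional set from `{q ∣ 3N}` to `{q ∣ 3M₀}` needs Deligne's theorem at the
  prescribed place, tree name `DeligneSerre1974.thm61_exists_adicGaloisRep` (unproved), plus
  Brauer–Nesbitt + Chebotarev (`dirichletDensity_eq_holds`, PROVED).  Debt-free alternative: attach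
  along a COFINITE exceptional set (`IsModularWeightTwoCofinite`), prime by prime, and let the
  (XL anyway) socket take that input — DDT Def. 3.12 is insensitive (Def. 3.12 + Thm. 3.1).

Kernel status: NO `sorry`; helper STATEMENTS are `def … : Prop`, every `theorem` is proved.
-/

noncomputable section

open scoped MatrixGroups Matrix NumberField ModularForm Polynomial
open Literature.NumberTheory Literature.NumberTheory.Automorphic
open Literature.NumberTheory.GaloisRepresentations Literature.NumberTheory.GaloisRepresentations.ModPGaloisRep
open Literature.NumberTheory.EllipticCurves Literature.NumberTheory.EllipticCurves.ModularForms
open IsDedekindDomain CongruenceSubgroup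

namespace Summit.ABC.ABC.Cruxes.FreyModularity.StubIdeas.LiftThree1g15

/-! ## §0 Weight slices (k1-g14, verbatim) and the cofinite weight-2 predicate (new) -/

/-- The weight-`w` slice of the tree's `ModPGaloisRep.IsModular` (k1-g14, verbatim).
[cite: BCDTJAMS2001, Introduction] -/
def IsModularOfWeight {k : Type} [Field k] [TopologicalSpace k] [DiscreteTopology k] (w : ℤ)
    (ρ : ModPGaloisRep ℚ k 2) : Prop :=
  ∃ (N : ℕ) (_ : NeZero N) (f : CuspForm (Gamma1 N) w) (K : Type) (_ : Field K)
    (_ : TopologicalSpace K) (_ : DiscreteTopology K) (j : k →+* K)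
    (ι : coeffCharIntegers f →+* K),
    IsNewform1 f ∧
      IsGaloisRepOfNewform1Int f ι {q | q ∣ N * ringChar k}
        (FramedRep.baseChange j continuous_of_discreteTopology ρ)

/-- DDT Def. 3.12 as typed by k1-g13 (`IsModularWeightTwo`, verbatim = the `w = 2` slice).
[cite: DarmonDiamondTaylor1995, Def. 3.12] -/
def IsModularWeightTwo {k : Type} [Field k] [TopologicalSpace k] [DiscreteTopology k]
    (ρ : ModPGaloisRep ℚ k 2) : Prop :=
  IsModularOfWeight 2 ρ

/-- **NEW (T3): weight-2 modularity with a COFINITE exceptional set** — `ρ̄ ⊗ K` is attached to a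
weight-2 newform `g ∈ S₂(Γ₁(N))` away from a finite set `S ⊇ {q ∣ N · char k}` (not necessarily
equal to it).  For absolutely irreducible `ρ̄` this is equivalent to `IsModularWeightTwo` granted
Deligne's Thm. 6.1 (`thm61_exists_adicGaloisRep`) + Brauer–Nesbitt + Chebotarev (DDT Def. 3.12 with
Thm. 3.1 / Prop. 3.4); it is what the weight-1 → weight-2 congruence delivers WITHOUT any Galois
representation attached to the weight-2 form. [cite: DarmonDiamondTaylor1995, Def. 3.12, Thm. 3.1] -/
def IsModularWeightTwoCofinite {k : Type} [Field k] [TopologicalSpace k] [DiscreteTopology k]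
    (ρ : ModPGaloisRep ℚ k 2) : Prop :=
  ∃ (N : ℕ) (_ : NeZero N) (g : CuspForm (Gamma1 N) 2) (K : Type) (_ : Field K)
    (_ : TopologicalSpace K) (_ : DiscreteTopology K) (j : k →+* K)
    (ι : coeffCharIntegers g →+* K) (S : Set ℕ),
    S.Finite ∧ {q | q ∣ N * ringChar k} ⊆ S ∧ IsNewform1 g ∧
      IsGaloisRepOfNewform1Int g ι S (FramedRep.baseChange j continuous_of_discreteTopology ρ)

/-- Sanity (PROVED): the level-exact predicate implies the cofinite one, over `𝔽_p`. [folklore] -/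
theorem isModularWeightTwoCofinite_of_isModularWeightTwo {p : ℕ} [Fact p.Prime]
    (ρ : ModPGaloisRep ℚ (ZMod p) 2) (h : IsModularWeightTwo ρ) :
    IsModularWeightTwoCofinite ρ := by
  obtain ⟨N, hN, g, K, hK, hT, hD, j, ι, hg, hatt⟩ := h
  refine ⟨N, hN, g, K, hK, hT, hD, j, ι, {q | q ∣ N * ringChar (ZMod p)}, ?_, le_rfl, hg, hatt⟩
  have hne : N * ringChar (ZMod p) ≠ 0 := by
    rw [ZMod.ringChar_zmod_n]
    exact mul_ne_zero (NeZero.ne N) (Fact.out : p.Prime).ne_zero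
  exact (Set.finite_Iic (N * ringChar (ZMod p))).subset fun q hq ↦ Nat.le_of_dvd
    (Nat.pos_of_ne_zero hne) hq

/-! ## §1 T1 — Langlands–Tunnell gives WEIGHT ONE (clone target, size S) -/

/-- **LTW1 (helper target, size S — a clone of the tree's
`ModPGaloisRep.isModular_of_isAbsolutelyIrreducible_of_isOdd_of_langlands_tunnell` with the weight
pinned)**: granted the tree's named fact `langlands_tunnell` (for every `σ`), every odd absolutely
irreducible `ρ̄ : Γ_ℚ → GL₂(𝔽₃)` is modular OF WEIGHT ONE.  The tree's proof already builds the tuple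
`⟨N, hN, 1, f, ℤ̄ ⧸ 𝔓, …⟩`; the clone drops the `1, …, le_refl _` components.
[cite: Gelbart1997, §1.4 Prop. 1.4, Steps 1–3 (pp. 158–161)] [cite: Wiles1995Annals, Ch. 5] -/
def LTWeightOne : Prop :=
  (∀ σ : FramedArtinRep ℚ 2, langlands_tunnell σ) →
    ∀ ρ : ModPGaloisRep ℚ (ZMod 3) 2, FramedRep.IsAbsolutelyIrreducible ρ →
      FramedGaloisRep.IsOdd ρ → IsModularOfWeight 1 ρ

/-- Sanity (PROVED): the weight-one slice is a slice — LTW1 re-implies the tree's any-weight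
conclusion. [folklore] -/
theorem isModular_of_isModularOfWeight {k : Type} [Field k] [TopologicalSpace k]
    [DiscreteTopology k] {w : ℤ} (hw : 1 ≤ w) (ρ : ModPGaloisRep ℚ k 2)
    (h : IsModularOfWeight w ρ) : ρ.IsModular := by
  obtain ⟨N, hN, f, K, hK, hT, hD, j, ι, hf, hatt⟩ := h
  exact ⟨N, hN, w, f, K, hK, hT, hD, j, ι, hw, hf, hatt⟩

/-- **LTW1, curve form (PROVED from LTW1)**: for `E/ℚ` and a framed model `ρ̄` of `E[3]` which is
absolutely irreducible, `ρ̄` is modular of weight one — oddness from `det ρ̄_{E,3} = χ̄₃` exactly as in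
the tree's `WeierstrassCurve.isModular_of_isTorsionGaloisRep_three_of_langlands_tunnell`.
[cite: BCDTJAMS2001, §2.2, proof of Thm. 2.2.1 (p. 862)] -/
theorem isModularOfWeightOne_of_isTorsionGaloisRep_three (h1 : LTWeightOne)
    (hLT : ∀ σ : FramedArtinRep ℚ 2, langlands_tunnell σ)
    (W : WeierstrassCurve ℚ) [W.IsElliptic] (ρ : ModPGaloisRep ℚ (ZMod 3) 2)
    (hρ : W.IsTorsionGaloisRep 3 ρ) (habs : FramedRep.IsAbsolutelyIrreducible ρ) :
    IsModularOfWeight 1 ρ := by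
  haveI : NeZero ((3 : ℕ) : ℚ) := ⟨by norm_num⟩
  have hodd : FramedGaloisRep.IsOdd ρ := by
    intro φ c hc
    rw [W.det_eq_modPCyclotomicCharacter_of_isTorsionGaloisRep_holds 3 ρ hρ c]
    ext
    rw [modPCyclotomicCharacterZMod_eq_modNCyclotomicCharacter,
      modNCyclotomicCharacter_of_isComplexConjugation hc, Units.val_neg, Units.val_one]
  exact h1 hLT ρ habs hodd

/-! ## §2 T2 — gen 14's H3 re-typed over an arbitrary residue field of characteristic 3 -/

/-- **H3′ (helper target, size M — the Deligne–Serre clone with multiplier `E13`, gen 14 §3,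
with the coefficient map generalised from `→+* ZMod 3` to `→+* k₀`, `k₀` ANY field of characteristic
`3`)**: for a weight-one newform `f ∈ S₁(Γ₁(N))` and `ι : 𝓞_f →+* k₀` there are a number field
`K ⊆ ℂ`, an embedding `i : K_f → K`, a finite place `v` of `K` over `ker ι` and a NEWFORM `g₀` of
WEIGHT 2 and level `M₀ ∣ 3N` with `K_{g₀} ⊆ K`, `v`-integral coefficients,
`a_p(g₀) ≡ a_p(f)` and `ε_{g₀}(p) p ≡ ε_f(p)` (mod `v`) for `p ∤ 3N`.  The clone of
`DeligneSerre1974.exists_eigenform_congr_of_weight_one` uses the codomain of `ι` only through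
"`ker ι` is maximal and contains `3`" (there: `ZMod.ringHom_surjective`; here: a non-zero prime of
the Dedekind domain `𝓞_{K_f}`), and its input (2.7.2) is the PROVED
`DeligneSerre1974_span_integralLattice1_holds N 1`.
[cite: DeligneSerreASENS1974, 6.9–6.11] [cite: DarmonDiamondTaylor1995, Rem. 3.6]
[cite: DiamondShurman2005, Thm. 5.8.2] -/
def WeightTwoNewformCongrThree' (N : ℕ) [NeZero N] : Prop :=
  ∀ (f : CuspForm (Gamma1 N) 1), IsNewform1 f →
    ∀ (k₀ : Type) [Field k₀] [CharP k₀ 3] (ι : coeffCharIntegers f →+* k₀),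
    ∃ (K : IntermediateField ℚ ℂ) (_ : NumberField K) (i : coeffCharField f →+* K)
      (v : HeightOneSpectrum (𝓞 K)) (M₀ : ℕ) (_ : NeZero M₀) (_ : M₀ ∣ N * 3)
      (g₀ : CuspForm (Gamma1 M₀) 2) (a : ℕ → K) (c : ZMod M₀ → K),
      coeffCharField g₀ ≤ K ∧ (∀ y, ((i y : K) : ℂ) = y) ∧
      IsNewform1 g₀ ∧ (∀ n, ((a n : K) : ℂ) = cuspCoeff g₀ n) ∧
      (∀ d, ((c d : K) : ℂ) = nebentypus g₀ d) ∧
      (∀ y : coeffCharIntegers f, ι y = 0 → v.valuation K (i y) < 1) ∧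
      (∀ n : ℕ, v.valuation K (a n) ≤ 1) ∧
      (∀ p : ℕ, p.Prime → ¬ p ∣ N * 3 →
        v.valuation K (a p - i ⟨cuspCoeff f p, cuspCoeff_mem_coeffCharField f p⟩) < 1) ∧
      (∀ p : ℕ, p.Prime → ¬ p ∣ N * 3 →
        v.valuation K (c p * p -
          i ⟨(nebentypus f (p : ZMod N) : ℂ), nebentypus_mem_coeffCharField f p⟩) < 1)

/-- **H3″ (recommended typing of H3′): the same statement quantified over MAXIMAL IDEALS
`𝔪 ∋ 3` of `𝓞_f`** instead of coefficient maps `ι` — no `Type` binder inside the `Prop`, and it is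
literally the shape in which the Deligne–Serre clone produces its output (`v` above `𝔪`).
[cite: DeligneSerreASENS1974, 6.9–6.11] -/
def WeightTwoNewformCongrThreeIdeal (N : ℕ) [NeZero N] : Prop :=
  ∀ (f : CuspForm (Gamma1 N) 1), IsNewform1 f →
    ∀ (𝔪 : Ideal (coeffCharIntegers f)), 𝔪.IsMaximal → (3 : coeffCharIntegers f) ∈ 𝔪 →
    ∃ (K : IntermediateField ℚ ℂ) (_ : NumberField K) (i : coeffCharField f →+* K)
      (v : HeightOneSpectrum (𝓞 K)) (M₀ : ℕ) (_ : NeZero M₀) (_ : M₀ ∣ N * 3)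
      (g₀ : CuspForm (Gamma1 M₀) 2) (a : ℕ → K) (c : ZMod M₀ → K),
      coeffCharField g₀ ≤ K ∧ (∀ y, ((i y : K) : ℂ) = y) ∧
      IsNewform1 g₀ ∧ (∀ n, ((a n : K) : ℂ) = cuspCoeff g₀ n) ∧
      (∀ d, ((c d : K) : ℂ) = nebentypus g₀ d) ∧
      (∀ y : coeffCharIntegers f, y ∈ 𝔪 → v.valuation K (i y) < 1) ∧
      (∀ n : ℕ, v.valuation K (a n) ≤ 1) ∧
      (∀ p : ℕ, p.Prime → ¬ p ∣ N * 3 →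
        v.valuation K (a p - i ⟨cuspCoeff f p, cuspCoeff_mem_coeffCharField f p⟩) < 1) ∧
      (∀ p : ℕ, p.Prime → ¬ p ∣ N * 3 →
        v.valuation K (c p * p -
          i ⟨(nebentypus f (p : ZMod N) : ℂ), nebentypus_mem_coeffCharField f p⟩) < 1)

/-- **(PROVED) H3″ ⇒ H3′**: the kernel of `ι : 𝓞_f →+* k₀` (`char k₀ = 3`) is a maximal ideal
containing `3` — `𝓞_f = \bar ℤ ∩ K_f` is integral over `ℤ` and `ker ι ∩ ℤ = (3)` (going-up,
`Ideal.isMaximal_of_isIntegral_of_isMaximal_comap`); this is the one place where the tree's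
`exists_eigenform_congr_of_weight_one` used `ZMod.ringHom_surjective`. [folklore] -/
theorem weightTwoNewformCongrThree'_of_ideal (N : ℕ) [NeZero N]
    (h : WeightTwoNewformCongrThreeIdeal N) : WeightTwoNewformCongrThree' N := by
  intro f hf k₀ _ _ ι
  haveI : Algebra.IsIntegral ℤ (coeffCharIntegers f) := by
    unfold coeffCharIntegers; infer_instance
  haveI hprime : (RingHom.ker ι).IsPrime := RingHom.ker_isPrime ι
  have h3z : (algebraMap ℤ (coeffCharIntegers f)) 3 ∈ RingHom.ker ι := by
    rw [RingHom.mem_ker, eq_intCast, map_intCast]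
    exact (CharP.intCast_eq_zero_iff k₀ 3 3).mpr (dvd_refl _)
  have h3 : (3 : coeffCharIntegers f) ∈ RingHom.ker ι := by simpa only [map_ofNat] using h3z
  haveI hmax3 : (Ideal.span {(3 : ℤ)}).IsMaximal :=
    PrincipalIdealRing.isMaximal_of_irreducible
      (Nat.prime_iff_prime_int.mp Nat.prime_three).irreducible
  have hcomap : (RingHom.ker ι).comap (algebraMap ℤ (coeffCharIntegers f)) =
      Ideal.span {(3 : ℤ)} :=
    (hmax3.eq_of_le (Ideal.comap_ne_top _ hprime.ne_top)
      ((Ideal.span_singleton_le_iff_mem _).mpr (Ideal.mem_comap.mpr h3z))).symm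
  have hmax : (RingHom.ker ι).IsMaximal :=
    Ideal.isMaximal_of_isIntegral_of_isMaximal_comap (R := ℤ) (RingHom.ker ι)
      (by rw [hcomap]; exact hmax3)
  obtain ⟨K, hK, i, v, M₀, hM₀, hdvd, g₀, a, c, h1, h2, h3', h4, h5, h6, h7, h8, h9⟩ :=
    h f hf (RingHom.ker ι) hmax h3
  exact ⟨K, hK, i, v, M₀, hM₀, hdvd, g₀, a, c, h1, h2, h3', h4, h5,
    fun y hy ↦ h6 y (RingHom.mem_ker.mpr hy), h7, h8, h9⟩

/-! ## §3 T3 — attachment along the congruence: cofinite (debt-free) vs level-exact (Deligne 6.1) -/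

/-- **H4a (helper target, size S, FACT-FREE): attach along the congruence, cofinitely.**  From
`IsModularOfWeight 1 ρ̄` (data `f, K, j, ι`, attached away from `3N`) and H3′ at `(f, K, ι)`:
with `S = {q ∣ 3N}`, `K' = 𝓞_K / v`, `j' : 𝔽₃ → K'` canonical and `ι' = (reduction mod v)|_{𝓞_{g₀}}`,
the attachment to `g₀` away from `S` is checked PRIME BY PRIME — unramifiedness is inherited, and
`charpoly ρ̄(Frob_p) ∈ 𝔽₃[X]` has an INTEGER lift `Q̃ ∈ ℤ[X]` with `P_f ≡ Q̃ (mod ker ι)` and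
`P_{g₀} ≡ i(P_f) ≡ Q̃ (mod v)` by H3′ (`ε_{g₀}(p) p ≡ ε_f(p)`): no Galois representation of `g₀`,
no Chebotarev, no irreducibility. [cite: DeligneSerreASENS1974, 6.7 (statement shape)] -/
def AttachCofinite : Prop :=
  (∀ (N : ℕ) [NeZero N], WeightTwoNewformCongrThree' N) →
    ∀ ρ : ModPGaloisRep ℚ (ZMod 3) 2, IsModularOfWeight 1 ρ → IsModularWeightTwoCofinite ρ

/-- **H4b (helper target, size M, ONE NAMED FACT): level-exact attachment** — for absolutely
irreducible `ρ̄`, cofinite attachment to `g₀` upgrades to attachment away from exactly `{q ∣ 3M₀}`,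
granted Deligne's Thm. 6.1 at the prescribed place `v` (tree: `DeligneSerre1974.thm61_exists_adicGaloisRep`,
unproved) — reduce `ρ_{g₀,v}` (`exists_integralModel`, `isOpen_ker_residualRep`,
`exists_semisimplification_fin_two`), compare with `ρ̄ ⊗ 𝔽̄₃` by Brauer–Nesbitt on the Frobenius-dense
set (`exists_isArithFrobAt_apply_eq`, Chebotarev PROVED: `dirichletDensity_eq_holds`), read off
unramifiedness and characteristic polynomials at `p ∣ N`, `p ∤ 3M₀`.  Template: `thm67_weightOne_core`.
Needed ONLY if the socket keeps the level-exact input `IsModularWeightTwo`.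
[cite: DeligneSerreASENS1974, Thm. 6.1, 6.12–6.13] [cite: DarmonDiamondTaylor1995, Thm. 3.1, Prop. 3.4] -/
def AttachAtLevel : Prop :=
  DeligneSerre1974.thm61_exists_adicGaloisRep →
    ∀ ρ : ModPGaloisRep ℚ (ZMod 3) 2, FramedRep.IsAbsolutelyIrreducible ρ →
      IsModularWeightTwoCofinite ρ → IsModularWeightTwo ρ

/-! ## §4 Assembly: the socket's weight-2 input for `E[3]`, with NO modularity hypothesis -/

/-- **The re-typed socket input at `ℓ = 3`** (replaces `IN1 3` in k1-g13's
`modularityLifting_tate_of_socket 3`): every framed `E[3]` which is absolutely irreducible is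
modular of weight 2, cofinitely.  No `ρ.IsModular` hypothesis — it is regenerated from
Langlands–Tunnell — hence no `IN1high 3`. [cite: Wiles1995Annals, Ch. 5] -/
def WeightTwoOfTorsionThree : Prop :=
  ∀ (W : WeierstrassCurve ℚ) [W.IsElliptic] (ρ : ModPGaloisRep ℚ (ZMod 3) 2),
    W.IsTorsionGaloisRep 3 ρ → FramedRep.IsAbsolutelyIrreducible ρ → IsModularWeightTwoCofinite ρ

/-- **(PROVED) `WeightTwoOfTorsionThree ⟸ LT (on-path fact) + LTW1 + H3′ + H4a`.** [folklore] -/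
theorem weightTwoOfTorsionThree_of_helpers
    (hLT : ∀ σ : FramedArtinRep ℚ 2, langlands_tunnell σ) (h1 : LTWeightOne)
    (h3 : ∀ (N : ℕ) [NeZero N], WeightTwoNewformCongrThree' N) (h4 : AttachCofinite) :
    WeightTwoOfTorsionThree :=
  fun W _ ρ hρ habs ↦
    h4 h3 ρ (isModularOfWeightOne_of_isTorsionGaloisRep_three h1 hLT W ρ hρ habs)

/-- **(PROVED) Level-exact variant** for a socket that insists on DDT Def. 3.12 verbatim: add H4b and
Deligne's Thm. 6.1. [folklore] -/
theorem isModularWeightTwo_of_isTorsionGaloisRep_three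
    (hLT : ∀ σ : FramedArtinRep ℚ 2, langlands_tunnell σ) (h1 : LTWeightOne)
    (h3 : ∀ (N : ℕ) [NeZero N], WeightTwoNewformCongrThree' N) (h4 : AttachCofinite)
    (h4b : AttachAtLevel) (h61 : DeligneSerre1974.thm61_exists_adicGaloisRep)
    (W : WeierstrassCurve ℚ) [W.IsElliptic] (ρ : ModPGaloisRep ℚ (ZMod 3) 2)
    (hρ : W.IsTorsionGaloisRep 3 ρ) (habs : FramedRep.IsAbsolutelyIrreducible ρ) :
    IsModularWeightTwo ρ :=
  h4b h61 ρ habs (weightTwoOfTorsionThree_of_helpers hLT h1 h3 h4 W ρ hρ habs)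

/-- **(PROVED) The stub's any-weight hypothesis is dischargeable but UNUSED**: whatever witness
`hmod : ρ.IsModular` the caller supplies, the weight-2 input is produced from `W`, `hρ`, `hirr` alone —
so a proof of `stub_liftThree` through the socket never inspects `hmod` (and `liftThree_of_stubs`
only ever feeds it the Langlands–Tunnell witness anyway). [folklore] -/
theorem socketInput_ignores_hmod (hW2 : WeightTwoOfTorsionThree)
    (W : WeierstrassCurve ℚ) [W.IsElliptic] (ρ : ModPGaloisRep ℚ (ZMod 3) 2)
    (hρ : W.IsTorsionGaloisRep 3 ρ) (hirr : ρ.IsAbsIrreducibleOverSqrt (-3))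
    (_hmod : ρ.IsModular) : IsModularWeightTwoCofinite ρ :=
  hW2 W ρ hρ hirr.isAbsolutelyIrreducible

end Summit.ABC.ABC.Cruxes.FreyModularity.StubIdeas.LiftThree1g15
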